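import Summits.AtomisticToContinuum.BoseEinsteinCondensation.Theorems.BECGroundStateSOSPeriodicIRBoundWFKinematics
import Summits.AtomisticToContinuum.BoseEinsteinCondensation.Theorems.BECGroundStateSOSPeriodicIRBoundWFRegularity
import Summits.AtomisticToContinuum.BoseEinsteinCondensation.Theorems.BECGroundStateSOSPeriodicIRBoundWFHeartKin
import Literature.MathematicalPhysics.QuantumManyBody.PeriodicBoseGasFracEnergy
import HarnessLib

/-!
# Crux `PeriodicIRBound` (stmt-AtomisticToContinuum-3972), line `fsum-phase-pencil`, helper S5-E
# `stub_fsumExcitedPairs` — the excited-pair mass identity and its ultraviolet tail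

For a periodic trial state `Ψ` of `n + 2` bosons on the cell `[0,L)³` and the first-quantised annihilation
operators `a_q = modeAn L (planeWaveMode L q)` of the normalised plane waves:

* `ExcitedPairs.tsum_normSq_modeAn_eq` — `∑_q ‖a_q Φ‖² = (n+1) ‖Φ‖²` for every continuous `(n+1)`-body `Φ`
  (Parseval in the traced variable, `tsum_cellOccupation_planeWaveMode_eq`), whence (E1)
  `∑_q ‖a_q a_0 Ψ‖² = (n+1) ‖a_0 Ψ‖²`;
* `ExcitedPairs.tsum_ite_normSq_modeAn_modeAn_zero_le` — (E2) the ultraviolet tail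
  `∑_{‖q‖_∞ > K} ‖a_q a_0 Ψ‖² ≤ (n+1) (L²/4π²K²) 𝓔_w[Ψ]`: termwise `‖a_q a_0Ψ‖² = ‖a_0 a_qΨ‖² ≤ (n+1)‖a_qΨ‖²`
  (`[a_q, a_0] = 0`, `n_0 ≤ N`), `1 ≤ (L²/4π²K²)|2πq/L|²` on the tail, and the kinetic Parseval
  `∑_q |2πq/L|² ‖a_qΨ‖² = T[Ψ] ≤ 𝓔_w[Ψ]`.
-/

noncomputable section

open MeasureTheory Filter
open scoped ENNReal NNReal ComplexConjugate BigOperators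

namespace Summit.AtomisticToContinuum.BoseEinsteinCondensation.Cruxes.PeriodicIRBound.FsumPhasePencil

open Literature.MathematicalPhysics.QuantumManyBody.BoseGas
open Summit.AtomisticToContinuum.BoseEinsteinCondensation.Cruxes.PeriodicIRBound.LinearPhFloorWagner.WF

namespace ExcitedPairs

variable {n : ℕ} {L : ℝ}

/-! ## (E1) The excited-pair mass identity -/

/-- **Parseval in the traced variable for `‖a_q ·‖²`**: `∑_q ‖a_q Φ‖² = (n+1) ‖Φ‖²` for a continuous
`(n+1)`-body `Φ` (`‖a_qΦ‖² = n_q(Φ)` and `∑_q n_q(Φ) = (n+1)‖Φ‖²`). [folklore] -/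
theorem tsum_normSq_modeAn_eq (hL : 0 < L) {Φ : Config (n + 1) → ℂ} (hΦ : Continuous Φ) :
    ∑' q : Fin 3 → ℤ, normSq L (modeAn L (planeWaveMode L q) Φ) = (n + 1 : ℝ≥0∞) * normSq L Φ := by
  simp only [normSq_modeAn_eq_cellOccupation]
  rw [tsum_cellOccupation_planeWaveMode_eq hL hΦ, Nat.cast_succ]
  rfl

/-- **(E1)** `∑_q ‖a_q a_0 Ψ‖² = (n+1) ‖a_0 Ψ‖²` for a periodic trial state `Ψ` of `n + 2` bosons. [folklore] -/
theorem tsum_normSq_modeAn_modeAn_zero (hL : 0 < L) (Ψ : PeriodicTrialState (n + 2) L) :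
    ∑' q : Fin 3 → ℤ, normSq L (modeAn L (planeWaveMode L q) (modeAn L (planeWaveMode L 0) Ψ.ψ)) =
      (n + 1 : ℝ≥0∞) * normSq L (modeAn L (planeWaveMode L 0) Ψ.ψ) :=
  tsum_normSq_modeAn_eq hL (isCore_modeAn hL 0 (isCore_trialState Ψ)).contDiff.continuous

/-! ## (E2) The ultraviolet tail -/

/-- On the tail `K < ‖q‖_∞` one has `4π²K²/L² ≤ |2πq/L|²` (the Euclidean norm dominates every coordinate).
[folklore] -/
theorem sq_div_le_norm_waveVector_sq {K : ℝ} (hK : 0 < K) {q : Fin 3 → ℤ}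
    (hq : K < ‖(fun j => (q j : ℝ))‖) : 4 * Real.pi ^ 2 * K ^ 2 / L ^ 2 ≤ ‖waveVector L q‖ ^ 2 := by
  rw [norm_waveVector_sq]
  obtain ⟨i, hi⟩ : ∃ i, K < |(q i : ℝ)| := by
    by_contra hcon
    push Not at hcon
    exact absurd hq (not_lt.2 ((pi_norm_le_iff_of_nonneg hK.le).2 fun i => by
      rw [Real.norm_eq_abs]; exact hcon i))
  have hKi : K ^ 2 ≤ (q i : ℝ) ^ 2 := by
    rw [← sq_abs (q i : ℝ)]
    exact pow_le_pow_left₀ hK.le hi.le 2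
  have hsum : (q i : ℝ) ^ 2 ≤ ∑ j, (q j : ℝ) ^ 2 :=
    Finset.single_le_sum (fun j _ => sq_nonneg ((q j : ℝ))) (Finset.mem_univ i)
  gcongr
  exact hKi.trans hsum

/-- On the tail `K < ‖q‖_∞`: `1 ≤ (L²/4π²K²) · |2πq/L|²` in `ℝ≥0∞`. [folklore] -/
theorem one_le_ofReal_mul_ofReal_norm_waveVector_sq (hL : 0 < L) {K : ℝ} (hK : 0 < K) {q : Fin 3 → ℤ}
    (hq : K < ‖(fun j => (q j : ℝ))‖) :
    (1 : ℝ≥0∞) ≤ ENNReal.ofReal (L ^ 2 / (4 * Real.pi ^ 2 * K ^ 2)) * ENNReal.ofReal (‖waveVector L q‖ ^ 2) := by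
  have hC : 0 ≤ L ^ 2 / (4 * Real.pi ^ 2 * K ^ 2) := by positivity
  rw [← ENNReal.ofReal_mul hC, ← ENNReal.ofReal_one]
  refine ENNReal.ofReal_le_ofReal ?_
  have hden : 4 * Real.pi ^ 2 * K ^ 2 ≠ 0 := by positivity
  have hL2 : L ^ 2 ≠ 0 := by positivity
  calc (1 : ℝ) = L ^ 2 / (4 * Real.pi ^ 2 * K ^ 2) * (4 * Real.pi ^ 2 * K ^ 2 / L ^ 2) := by
        rw [div_mul_div_comm, mul_comm (4 * Real.pi ^ 2 * K ^ 2) (L ^ 2), div_self (mul_ne_zero hL2 hden)]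
    _ ≤ L ^ 2 / (4 * Real.pi ^ 2 * K ^ 2) * ‖waveVector L q‖ ^ 2 := by
        gcongr
        exact sq_div_le_norm_waveVector_sq hK hq

/-- Termwise: `‖a_q a_0 Ψ‖² = ‖a_0 a_q Ψ‖² = n_0(a_qΨ) ≤ (n+1) ‖a_q Ψ‖²` (`[a_q, a_0] = 0` on Bose-symmetric
functions; an occupation is at most the particle number times the norm). [folklore] -/
theorem normSq_modeAn_modeAn_zero_le (hL : 0 < L) (q : Fin 3 → ℤ) (Ψ : PeriodicTrialState (n + 2) L) :
    normSq L (modeAn L (planeWaveMode L q) (modeAn L (planeWaveMode L 0) Ψ.ψ)) ≤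
      (n + 1 : ℝ≥0∞) * normSq L (modeAn L (planeWaveMode L q) Ψ.ψ) := by
  have hΨ : IsCore L Ψ.ψ := isCore_trialState Ψ
  rw [modeAn_modeAn_planeWaveMode_comm q 0 hΨ.contDiff.continuous hΨ.symm, normSq_modeAn hL]
  have h := cellOccupation_le_mul_normSq hL 0 (isCore_modeAn hL q hΨ).contDiff.continuous
  rwa [Nat.cast_succ] at h

/-- **(E2)** The ultraviolet tail of the excited-pair mass:
`∑_{‖q‖_∞ > K} ‖a_q a_0 Ψ‖² ≤ (n+1) (L²/4π²K²) 𝓔_w[Ψ]` (termwise bound, `1 ≤ (L²/4π²K²)|2πq/L|²` on the tail,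
kinetic Parseval `∑_q |2πq/L|²‖a_qΨ‖² = T[Ψ] ≤ 𝓔_w[Ψ]`). [folklore] -/
theorem tsum_ite_normSq_modeAn_modeAn_zero_le (hL : 0 < L) (w : ℝ → ℝ≥0∞) (Ψ : PeriodicTrialState (n + 2) L)
    {K : ℝ} (hK : 0 < K) :
    ∑' q : Fin 3 → ℤ, (if K < ‖(fun j => (q j : ℝ))‖ then
        normSq L (modeAn L (planeWaveMode L q) (modeAn L (planeWaveMode L 0) Ψ.ψ)) else 0) ≤
      (n + 1 : ℝ≥0∞) * ENNReal.ofReal (L ^ 2 / (4 * Real.pi ^ 2 * K ^ 2)) * periodicEnergy w Ψ := by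
  -- termwise bound by the kinetic weights
  have hterm : ∀ q : Fin 3 → ℤ, (if K < ‖(fun j => (q j : ℝ))‖ then
      normSq L (modeAn L (planeWaveMode L q) (modeAn L (planeWaveMode L 0) Ψ.ψ)) else 0) ≤
      (n + 1 : ℝ≥0∞) * ENNReal.ofReal (L ^ 2 / (4 * Real.pi ^ 2 * K ^ 2)) *
        (ENNReal.ofReal (‖waveVector L q‖ ^ 2) * normSq L (modeAn L (planeWaveMode L q) Ψ.ψ)) := by
    intro q
    split_ifs with hq
    · calc normSq L (modeAn L (planeWaveMode L q) (modeAn L (planeWaveMode L 0) Ψ.ψ))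
          ≤ (n + 1 : ℝ≥0∞) * (1 * normSq L (modeAn L (planeWaveMode L q) Ψ.ψ)) := by
            rw [one_mul]
            exact normSq_modeAn_modeAn_zero_le hL q Ψ
        _ ≤ (n + 1 : ℝ≥0∞) * (ENNReal.ofReal (L ^ 2 / (4 * Real.pi ^ 2 * K ^ 2)) *
              ENNReal.ofReal (‖waveVector L q‖ ^ 2) * normSq L (modeAn L (planeWaveMode L q) Ψ.ψ)) := by
            gcongr
            exact one_le_ofReal_mul_ofReal_norm_waveVector_sq hL hK hq
        _ = (n + 1 : ℝ≥0∞) * ENNReal.ofReal (L ^ 2 / (4 * Real.pi ^ 2 * K ^ 2)) *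
              (ENNReal.ofReal (‖waveVector L q‖ ^ 2) * normSq L (modeAn L (planeWaveMode L q) Ψ.ψ)) := by
            ring
    · exact bot_le
  calc ∑' q : Fin 3 → ℤ, (if K < ‖(fun j => (q j : ℝ))‖ then
        normSq L (modeAn L (planeWaveMode L q) (modeAn L (planeWaveMode L 0) Ψ.ψ)) else 0)
      ≤ ∑' q : Fin 3 → ℤ, (n + 1 : ℝ≥0∞) * ENNReal.ofReal (L ^ 2 / (4 * Real.pi ^ 2 * K ^ 2)) *
          (ENNReal.ofReal (‖waveVector L q‖ ^ 2) * normSq L (modeAn L (planeWaveMode L q) Ψ.ψ)) :=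
        ENNReal.tsum_le_tsum hterm
    _ = (n + 1 : ℝ≥0∞) * ENNReal.ofReal (L ^ 2 / (4 * Real.pi ^ 2 * K ^ 2)) *
          ∫⁻ X in cellN (n + 2) L, kineticDensity Ψ.ψ X := by
        rw [ENNReal.tsum_mul_left, lintegral_kineticDensity_eq_tsum_normSq_modeAn hL (isCore_trialState Ψ)]
    _ ≤ (n + 1 : ℝ≥0∞) * ENNReal.ofReal (L ^ 2 / (4 * Real.pi ^ 2 * K ^ 2)) * periodicEnergy w Ψ := by
        gcongr
        rw [periodicEnergy_eq_qform]
        exact lintegral_mono fun X => le_self_add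

end ExcitedPairs

/-- **Registered helper sub-goal `stub_fsumExcitedPairs`** (line `fsum-phase-pencil`, S5-E): the excited-pair mass
identity `∑_q ‖a_q a_0 Ψ‖² = (n+1)‖a_0Ψ‖²` and its ultraviolet tail bound
`∑_{‖q‖_∞ > K} ‖a_q a_0 Ψ‖² ≤ (n+1) (L²/4π²K²) 𝓔_w[Ψ]` (`ExcitedPairs.tsum_normSq_modeAn_modeAn_zero`,
`ExcitedPairs.tsum_ite_normSq_modeAn_modeAn_zero_le`). [folklore] -/
theorem stub_fsumExcitedPairs : (∀ {n : ℕ} {L : ℝ}, 0 < L → ∀ (Ψ : PeriodicTrialState (n + 2) L), ∑' q : Fin 3 → ℤ, normSq L (modeAn L (planeWaveMode L q) (modeAn L (planeWaveMode L 0) Ψ.ψ)) = (n + 1 : ℝ≥0∞) * normSq L (modeAn L (planeWaveMode L 0) Ψ.ψ)) ∧ (∀ {n : ℕ} {L : ℝ}, 0 < L → ∀ (w : ℝ → ℝ≥0∞) (Ψ : PeriodicTrialState (n + 2) L) (K : ℝ), 0 < K → ∑' q : Fin 3 → ℤ, (if K < ‖(fun j => (q j : ℝ))‖ then normSq L (modeAn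 L (planeWaveMode L q) (modeAn L (planeWaveMode L 0) Ψ.ψ)) else 0) ≤ (n + 1 : ℝ≥0∞) * ENNReal.ofReal (L ^ 2 / (4 * Real.pi ^ 2 * K ^ 2)) * periodicEnergy w Ψ) :=
  ⟨fun hL Ψ => ExcitedPairs.tsum_normSq_modeAn_modeAn_zero hL Ψ,
    fun hL w Ψ _ hK => ExcitedPairs.tsum_ite_normSq_modeAn_modeAn_zero_le hL w Ψ hK⟩

end Summit.AtomisticToContinuum.BoseEinsteinCondensation.Cruxes.PeriodicIRBound.FsumPhasePencil

end
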